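import Literature.MathematicalPhysics.QuantumManyBody.BoseGasSineProfileIntegrals
import HarnessLib

/-!
# The free Dirichlet ground-state energy: `E₀^D(0, N, L) ≤ 3N (π/L)² (1 + η)` for large boxes

Topic `Literature/MathematicalPhysics/QuantumManyBody`, namespace `…BoseGas`; the product trial
state `Ψ(X) = ∏_{(i,k)} g(x_{i,k})` built on the near-optimal one-dimensional profile `g` of
`BoseGasSineProfileIntegrals.lean` (`∫g² = 1`, `∫g'² ≤ (π/L)²(1+η)`, `g ∈ C¹_c((0,L))`), with
the flattening `(ℝ³)^N ≅ ℝ^{N×3}` of `FreeDirichletGap.lean` (`volume_preserving_configFlatten`)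
and the product-derivative formula `fderiv_prodCutoff_single` of
`DiluteBoseGasUpperBoundLocalization.lean`:

* `exists_freeProductState` — for every `η > 0` there is `L₀` such that for every `L ≥ L₀` and
  every `N` some Dirichlet trial state `Ψ` of `N` bosons in `Λ_L` has
  `energy 0 Ψ ≤ ofReal (3N(π/L)²(1+η))`; hence
* `groundStateEnergy_zero_le_of_ge` — `E₀^D(0, N, L) ≤ ofReal (3N(π/L)²(1+η))` for `L ≥ L₀(η)`.

With the free Dirichlet gap (`freeDirichletGap`: `E₀^D(0,N,L) ≥ 3Nπ²/L²`) this pins the free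
ground-state energy of the `C¹` variational class to `3Nπ²/L² (1 + o(1))` as `L → ∞`
[LSSY2005, Ch. 2 (2.3)].  No definitions.

## References

* [LSSY2005] E. H. Lieb, R. Seiringer, J. P. Solovej, J. Yngvason, *The Mathematics of the Bose
  Gas and its Condensation* (2005), Ch. 2 (2.3).
-/

noncomputable section

namespace Literature.MathematicalPhysics.QuantumManyBody.BoseGas

open _root_.MeasureTheory _root_.Filter _root_.Set _root_.Real
open scoped ENNReal NNReal Topology BigOperators

variable {N : ℕ}

/-- `∫ ∏_p h_p(y_p) dy = ∏_p ∫ h_p` on `ℝ^{N×3}`, pulled back to configuration space: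
for nonnegative integrable real factors, `∫⁻_{(ℝ³)^N} ofReal (∏_{(i,k)} h_{(i,k)}(x_{i,k})) =
ofReal (∏_{(i,k)} ∫ h_{(i,k)})`. [folklore] -/
theorem lintegral_ofReal_prod_coord (h : Fin N × Fin 3 → ℝ → ℝ) (hnn : ∀ p t, 0 ≤ h p t)
    (hint : ∀ p, Integrable (h p)) :
    ∫⁻ X : Config N, ENNReal.ofReal (∏ p : Fin N × Fin 3, h p (X p.1 p.2)) =
      ENNReal.ofReal (∏ p : Fin N × Fin 3, ∫ t, h p t) := by
  set e := ((MeasurableEquiv.piCongrRight fun _ : Fin N =>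
      (MeasurableEquiv.toLp 2 (Fin 3 → ℝ)).symm).trans (MeasurableEquiv.curry (Fin N) (Fin 3) ℝ).symm)
    with he
  have hmp : MeasurePreserving e volume volume := volume_preserving_configFlatten N
  have hcomp : ∫⁻ X : Config N, ENNReal.ofReal (∏ p : Fin N × Fin 3, h p (e X p)) =
      ∫⁻ y : Fin N × Fin 3 → ℝ, ENNReal.ofReal (∏ p : Fin N × Fin 3, h p (y p)) :=
    hmp.lintegral_comp_emb e.measurableEmbedding
      (fun y : Fin N × Fin 3 → ℝ => ENNReal.ofReal (∏ p : Fin N × Fin 3, h p (y p)))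
  have heq : ∀ X : Config N, (∏ p : Fin N × Fin 3, h p (X p.1 p.2)) = ∏ p : Fin N × Fin 3, h p (e X p) :=
    fun X => rfl
  simp_rw [heq]
  rw [hcomp]
  have hI : Integrable (fun y : Fin N × Fin 3 → ℝ => ∏ p : Fin N × Fin 3, h p (y p)) := by
    have := Integrable.fintype_prod (f := h) (μ := fun _ => volume) hint
    simpa only [volume_pi] using this
  rw [← ofReal_integral_eq_lintegral_ofReal hI (ae_of_all _ fun y => Finset.prod_nonneg fun p _ => hnn p _),
    integral_fintype_prod_volume_eq_prod]

/-- **The free product trial state.**  For every `η > 0` there is `L₀ > 0` such that for every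
`L ≥ L₀` and every `N` there is a Dirichlet trial state `Ψ = ∏_{(i,k)} g(x_{i,k})` of `N` bosons in
`Λ_L` with `energy 0 Ψ ≤ ofReal (3N (π/L)² (1 + η))` (`g` the near-optimal profile:
`∫g² = 1`, `∫g'² ≤ (π/L)²(1+η)`; the kinetic energy of the product is `3N ∫g'²`).
[cite: LSSY2005, Ch. 2 (2.3)] -/
theorem exists_freeProductState {η : ℝ} (hη : 0 < η) :
    ∃ L₀ : ℝ, 0 < L₀ ∧ ∀ L : ℝ, L₀ ≤ L → ∀ N : ℕ, ∃ Ψ : TrialState N L,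
      energy 0 Ψ ≤ ENNReal.ofReal (3 * N * (π / L) ^ 2 * (1 + η)) := by
  obtain ⟨L₀, hL₀, H⟩ := exists_nearOptimal_profile hη
  refine ⟨L₀, hL₀, fun L hL N => ?_⟩
  obtain ⟨g, hgc, hgs, hgz, hgd, hg1, hgJ⟩ := H L hL
  classical
  -- the product wave function
  set F : Config N → ℝ := fun X => ∏ p : Fin N × Fin 3, g (X p.1 p.2) with hF
  have hFc : ContDiff ℝ 1 F := contDiff_prod fun p _ =>
    hgc.comp ((EuclideanSpace.proj p.2).comp (ContinuousLinearMap.proj (R := ℝ) p.1) : Config N →L[ℝ] ℝ).contDiff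
  set ψ : Config N → ℂ := fun X => ((F X : ℝ) : ℂ) with hψ
  have hψc : ContDiff ℝ 1 ψ := Complex.ofRealCLM.contDiff.comp hFc
  -- integrals of the factors
  have hint_g2 : Integrable fun t => g t ^ 2 := by
    have h : Integrable (fun t => g t * g t) :=
      (hgc.continuous.mul hgc.continuous).integrable_of_hasCompactSupport hgs.mul_right
    simpa [pow_two] using h
  have hint_d2 : Integrable fun t => deriv g t ^ 2 := by
    have h : Integrable (fun t => deriv g t * deriv g t) :=
      (hgd.mul hgd).integrable_of_hasCompactSupport hgs.deriv.mul_right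
    simpa [pow_two] using h
  -- the normalisation
  have hnorm : ∫⁻ X, ((‖ψ X‖₊ : ℝ≥0∞)) ^ 2 = 1 := by
    have hpt : ∀ X, ((‖ψ X‖₊ : ℝ≥0∞)) ^ 2 = ENNReal.ofReal (∏ p : Fin N × Fin 3, g (X p.1 p.2) ^ 2) := by
      intro X
      rw [ennnorm_sq_eq_ofReal, hψ]
      simp only [Complex.norm_real, Real.norm_eq_abs, sq_abs, hF, ← Finset.prod_pow]
    simp_rw [hpt]
    rw [lintegral_ofReal_prod_coord (fun _ t => g t ^ 2) (fun _ _ => sq_nonneg _) fun _ => hint_g2]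
    simp [hg1]
  -- the trial state
  let Ψ : TrialState N L :=
    { ψ := ψ
      contDiff := hψc
      eq_zero := fun X hX => by
        obtain ⟨i, k, hik⟩ : ∃ i k, X i k ∉ Ioo (0 : ℝ) L := by
          by_contra hall; push Not at hall; exact hX fun i k => hall i k
        have : F X = 0 := Finset.prod_eq_zero (Finset.mem_univ (i, k)) (hgz _ hik)
        simp [hψ, this]
      symm := fun σ X => by
        simp only [hψ, hF, Function.comp_apply]
        congr 1
        exact Equiv.prod_comp (σ.prodCongr (Equiv.refl (Fin 3))) (fun q : Fin N × Fin 3 => g (X q.1 q.2))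
      norm_eq := hnorm }
  refine ⟨Ψ, ?_⟩
  -- the kinetic energy of the product
  have hderiv : ∀ (X : Config N) (i : Fin N) (k : Fin 3),
      ((‖fderiv ℝ ψ X (Pi.single i (EuclideanSpace.single k (1 : ℝ)))‖₊ : ℝ≥0∞)) ^ 2 =
        ENNReal.ofReal (∏ p : Fin N × Fin 3, (if p = (i, k) then deriv g (X p.1 p.2) ^ 2 else g (X p.1 p.2) ^ 2)) := by
    intro X i k
    have hFd : HasFDerivAt F (fderiv ℝ F X) X := (hFc.differentiable one_ne_zero X).hasFDerivAt
    have hψd : HasFDerivAt ψ (Complex.ofRealCLM.comp (fderiv ℝ F X)) X := Complex.ofRealCLM.hasFDerivAt.comp X hFd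
    rw [hψd.fderiv, ContinuousLinearMap.comp_apply, Complex.ofRealCLM_apply, hF,
      fderiv_prodCutoff_single hgc X i k, ennnorm_sq_eq_ofReal, Complex.norm_real, Real.norm_eq_abs, sq_abs]
    congr 1
    rw [mul_pow, ← Finset.prod_pow, ← Finset.mul_prod_erase Finset.univ _ (Finset.mem_univ (i, k))]
    simp only [if_true]
    congr 1
    exact Finset.prod_congr rfl fun p hp => by rw [if_neg (Finset.ne_of_mem_erase hp)]
  have hkin : ∫⁻ X, kineticDensity ψ X = 3 * N * ENNReal.ofReal (∫ t, deriv g t ^ 2) := by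
    unfold kineticDensity
    rw [lintegral_finsetSum Finset.univ fun i _ => Finset.measurable_sum Finset.univ fun k _ =>
      measurable_ennnormSq_fderiv_apply hψc _]
    have hik : ∀ (i : Fin N) (k : Fin 3),
        ∫⁻ X, ((‖fderiv ℝ ψ X (Pi.single i (EuclideanSpace.single k (1 : ℝ)))‖₊ : ℝ≥0∞)) ^ 2 =
          ENNReal.ofReal (∫ t, deriv g t ^ 2) := by
      intro i k
      simp_rw [hderiv]
      rw [lintegral_ofReal_prod_coord (fun p t => if p = (i, k) then deriv g t ^ 2 else g t ^ 2)
        (fun p t => by split_ifs <;> positivity) (fun p => by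
          by_cases hp : p = (i, k)
          · simp only [hp, if_true]; exact hint_d2
          · simp only [hp, if_false]; exact hint_g2)]
      congr 1
      have : ∀ p : Fin N × Fin 3, (∫ t, (if p = (i, k) then deriv g t ^ 2 else g t ^ 2)) =
          if p = (i, k) then ∫ t, deriv g t ^ 2 else 1 := by
        intro p; split_ifs <;> simp [hg1]
      simp_rw [this]
      rw [Finset.prod_ite_eq']; simp
    simp_rw [lintegral_finsetSum Finset.univ fun k _ => measurable_ennnormSq_fderiv_apply hψc _, hik]
    simp only [Finset.sum_const, Finset.card_univ, Fintype.card_fin, nsmul_eq_mul]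
    push_cast; ring
  -- the energy
  have hint0 : ∀ X : Config N, interaction 0 X = 0 := fun X => by simp [interaction]
  calc energy 0 Ψ = ∫⁻ X, kineticDensity ψ X := by
        simp only [energy, hint0, zero_mul, add_zero]; rfl
    _ = 3 * N * ENNReal.ofReal (∫ t, deriv g t ^ 2) := hkin
    _ ≤ 3 * N * ENNReal.ofReal ((π / L) ^ 2 * (1 + η)) := by gcongr
    _ = ENNReal.ofReal (3 * N * (π / L) ^ 2 * (1 + η)) := by
        rw [ENNReal.ofReal_mul (p := 3 * N * (π / L) ^ 2) (by positivity),
          ENNReal.ofReal_mul (p := 3 * N) (by positivity), ENNReal.ofReal_mul (p := 3) (by norm_num),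
          ENNReal.ofReal_natCast, ENNReal.ofReal_ofNat,
          ENNReal.ofReal_mul (p := (π / L) ^ 2) (by positivity)]
        ring

/-- **The free Dirichlet energy of a large box**: for every `η > 0` there is `L₀` with
`E₀^D(0, N, L) ≤ ofReal (3N(π/L)²(1+η))` for all `L ≥ L₀` and all `N`. [cite: LSSY2005, Ch. 2 (2.3)] -/
theorem groundStateEnergy_zero_le_of_ge {η : ℝ} (hη : 0 < η) :
    ∃ L₀ : ℝ, 0 < L₀ ∧ ∀ L : ℝ, L₀ ≤ L → ∀ N : ℕ,
      groundStateEnergy 0 N L ≤ ENNReal.ofReal (3 * N * (π / L) ^ 2 * (1 + η)) := by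
  obtain ⟨L₀, hL₀, H⟩ := exists_freeProductState hη
  refine ⟨L₀, hL₀, fun L hL N => ?_⟩
  obtain ⟨Ψ, hΨ⟩ := H L hL N
  exact (groundStateEnergy_le_energy 0 Ψ).trans hΨ

end Literature.MathematicalPhysics.QuantumManyBody.BoseGas

end
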